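import Summits.Ventures.YMGap.RobustBall.TermPerturbation
import HarnessLib

/-!
# RobustBall/TermPerturbationWeighted — WEIGHTED loads of an assembled perturbation and membership in the TIER-2 ball
(cell `pub-ymgap`, track Y2 ROBUST-BALL; ds-4)

HONEST FRAMING: elementary finite-torus bookkeeping (no probability, no continuum, no Clay claim).  The tier-2 twin of p1's
`RobustBall/TermPerturbation` load formulas: for a finite family `T : ι → LocalTerm d L N` and a weight `κ`, the diameter-weighted
loads of `termPerturbation T` under the tree's SITE incidence are
`oscLoad κ e = Σ_r e^{κ diam(code r)} · oscC_r · mult_r(e)` and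
`selfLipLoad κ e + crossLipLoad κ e = Σ_{r : e.1 ∈ code r} e^{κ diam(code r)} · lipC_r · |letters_r|`,
hence membership in rb-theory's diameter-weighted ball `ClusterDomain κ ε₀ ε₁` from two counting bounds
(`termPerturbation_mem_clusterDomain`) — the entrance for infinite-range members (families whose codes have unbounded diameter
and exponentially small coefficients).  Also the vertical-window lemma with ONE window per polymer shared by all terms placed on
it (`hasVertRange_termPerturbation_of_fiber`), for families whose code is not injective.
-/

noncomputable section

open MeasureTheory Finset Function
open Literature.Probability.LatticeModels Literature.Probability.LatticeModels.DobrushinMetric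
open Literature.MathematicalPhysics.QuantumLattice hiding torusNorm
open Literature.MathematicalPhysics.QuantumFieldTheory hiding ZdEdge

namespace Summit.Ventures.YMGap.RobustBall

variable {d L N : ℕ} {ι : Type*} [Fintype ι] [NeZero L] (T : ι → LocalTerm d L N)

/-! ### Weighted load formulas -/

/-- Double sums over (polymers through the SITE `e.1`) × (fiber), with a polymer-dependent weight, collapse to a sum over the
terms whose code contains `e.1`, the weight evaluated at the term's code. [folklore] -/
theorem sum_polymersThroughEdge_weight_fiber (e : Edge d L) (φ : Finset (Site d L) → ℝ) (g : ι → ℝ) :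
    ∑ X ∈ polymersThroughEdge e, φ X * ∑ r ∈ fiber T X, g r =
      ∑ r, if e.1 ∈ (T r).code then φ (T r).code * g r else 0 := by
  have h : ∀ X ∈ polymersThroughEdge e, φ X * ∑ r ∈ fiber T X, g r = ∑ r ∈ fiber T X, φ (T r).code * g r := by
    intro X _
    rw [mul_sum]
    exact sum_congr rfl fun r hr => by rw [(mem_fiber T).1 hr]
  rw [sum_congr rfl h]
  exact sum_polymersThroughEdge_fiber T e fun r => φ (T r).code * g r

/-- **Weighted oscillation load** (site incidence): `a_κ(e) = Σ_r e^{κ diam(code r)} · oscC_r · mult_r(e)`. [folklore] -/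
theorem oscLoad_weighted_eq (κ : ℝ) (e : Edge d L) :
    (termLoadWitness T).oscLoad κ e =
      ∑ r, Real.exp (κ * polymerDiam (T r).code) * ((T r).oscC * (mult (T r).letters e : ℝ)) := by
  simp only [LoadWitness.oscLoad, termLoadWitness_osc]
  rw [sum_polymersThroughEdge_weight_fiber T e (fun X => Real.exp (κ * polymerDiam X))
    (fun r => (T r).oscC * (mult (T r).letters e : ℝ))]
  refine sum_congr rfl fun r _ => ?_
  by_cases h : e.1 ∈ (T r).code
  · rw [if_pos h]
  · rw [if_neg h]
    by_cases hm : mult (T r).letters e = 0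
    · rw [hm]; simp
    · exact absurd ((T r).fst_mem_code_of_mult_ne_zero hm) h

/-- **Weighted self-Lipschitz load** (site incidence): `ℓ_{s,κ}(e) = Σ_r e^{κ diam(code r)} · lipC_r · mult_r(e)`. [folklore] -/
theorem selfLipLoad_weighted_eq (κ : ℝ) (e : Edge d L) :
    (termLoadWitness T).selfLipLoad κ e =
      ∑ r, Real.exp (κ * polymerDiam (T r).code) * ((T r).lipC * (mult (T r).letters e : ℝ)) := by
  simp only [LoadWitness.selfLipLoad, termLoadWitness_lip]
  rw [sum_polymersThroughEdge_weight_fiber T e (fun X => Real.exp (κ * polymerDiam X))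
    (fun r => (T r).lipC * (mult (T r).letters e : ℝ))]
  refine sum_congr rfl fun r _ => ?_
  by_cases h : e.1 ∈ (T r).code
  · rw [if_pos h]
  · rw [if_neg h]
    by_cases hm : mult (T r).letters e = 0
    · rw [hm]; simp
    · exact absurd ((T r).fst_mem_code_of_mult_ne_zero hm) h

/-- **Weighted cross-Lipschitz coefficient** (site incidence): `ℓ_κ(e,y) = Σ_{r : e.1 ∈ code r} e^{κ diam(code r)} · lipC_r · mult_r(y)`.
[folklore] -/
theorem crossLip_weighted_eq (κ : ℝ) (e y : Edge d L) :
    (termLoadWitness T).crossLip κ e y =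
      ∑ r, if e.1 ∈ (T r).code then Real.exp (κ * polymerDiam (T r).code) * ((T r).lipC * (mult (T r).letters y : ℝ))
        else 0 := by
  simp only [LoadWitness.crossLip, termLoadWitness_lip]
  have step : ∀ X ∈ polymersThroughEdge e,
      (if y ∈ polymerEdges 1 X then
          Real.exp (κ * polymerDiam X) * ∑ r ∈ fiber T X, (T r).lipC * (mult (T r).letters y : ℝ) else 0) =
        Real.exp (κ * polymerDiam X) * ∑ r ∈ fiber T X, (T r).lipC * (mult (T r).letters y : ℝ) := by
    intro X _
    split_ifs with hy
    · rfl
    · rw [eq_comm, mul_eq_zero]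
      refine Or.inr (sum_eq_zero fun r hr => ?_)
      by_cases hm : mult (T r).letters y = 0
      · rw [hm]; simp
      · have h1 : y.1 ∈ X := (mem_fiber T).1 hr ▸ (T r).fst_mem_code_of_mult_ne_zero hm
        exact absurd (by simpa using h1) hy
  rw [sum_filter, sum_congr rfl step,
    sum_polymersThroughEdge_weight_fiber T e (fun X => Real.exp (κ * polymerDiam X))
      (fun r => (T r).lipC * (mult (T r).letters y : ℝ))]

/-- **Weighted total Lipschitz load** (site incidence):
`ℓ_{s,κ}(e) + Λ_κ(e) = Σ_{r : e.1 ∈ code r} e^{κ diam(code r)} · lipC_r · |letters_r|`. [folklore] -/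
theorem selfLipLoad_add_crossLipLoad_weighted_eq (κ : ℝ) (e : Edge d L) :
    (termLoadWitness T).selfLipLoad κ e + (termLoadWitness T).crossLipLoad κ e =
      ∑ r, if e.1 ∈ (T r).code then Real.exp (κ * polymerDiam (T r).code) * ((T r).lipC * ((T r).letters.length : ℝ))
        else 0 := by
  rw [selfLipLoad_weighted_eq, LoadWitness.crossLipLoad]
  simp only [crossLip_weighted_eq]
  rw [sum_comm, ← sum_add_distrib]
  refine sum_congr rfl fun r _ => ?_
  by_cases h : e.1 ∈ (T r).code
  · simp only [if_pos h, ← mul_sum, ← mul_add]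
    congr 2
    rw [Finset.add_sum_erase univ (fun y => (mult (T r).letters y : ℝ)) (mem_univ e)]
    exact_mod_cast sum_mult_eq_length (T r).letters
  · simp only [if_neg h, sum_const_zero, add_zero]
    by_cases hm : mult (T r).letters e = 0
    · rw [hm]; simp
    · exact absurd ((T r).fst_mem_code_of_mult_ne_zero hm) h

/-- **Membership in the TIER-2 ball from two weighted counts** (site incidence): if
`Σ_r e^{κ diam(code r)} oscC_r · mult_r(e) ≤ ε₀` and `Σ_{r : e.1 ∈ code r} e^{κ diam(code r)} lipC_r · |letters_r| ≤ ε₁` at every link `e`,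
then the assembled perturbation lies in `ClusterDomain κ ε₀ ε₁` — no range hypothesis. [folklore] -/
theorem termPerturbation_mem_clusterDomain {κ ε₀ ε₁ : ℝ}
    (h₀ : ∀ e : Edge d L, ∑ r, Real.exp (κ * polymerDiam (T r).code) * ((T r).oscC * (mult (T r).letters e : ℝ)) ≤ ε₀)
    (h₁ : ∀ e : Edge d L, ∑ r, (if e.1 ∈ (T r).code then
      Real.exp (κ * polymerDiam (T r).code) * ((T r).lipC * ((T r).letters.length : ℝ)) else 0) ≤ ε₁) :
    termPerturbation T ∈ ClusterDomain κ ε₀ ε₁ := by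
  refine ⟨termLoadWitness T, fun e => ?_, fun e => ?_⟩
  · rw [oscLoad_weighted_eq]; exact h₀ e
  · rw [selfLipLoad_add_crossLipLoad_weighted_eq]; exact h₁ e

/-! ### Vertical windows shared by the terms of one polymer -/

/-- **Vertical dependence diameter from FIBER windows** (no injectivity): if for every polymer `X` and direction `v` ONE window
of `m` consecutive `v`-heights contains the `v`-letters of EVERY term placed on `X`, the assembled perturbation has
`HasVertRange m`. [folklore] -/
theorem hasVertRange_termPerturbation_of_fiber {m : ℕ}
    (hwin : ∀ (X : Finset (Site d L)) (v : Fin d), ∃ t₀ : ZMod L, ∀ r ∈ fiber T X, ∀ l ∈ (T r).letters,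
      l.dir = v → ∃ k : ℕ, k < m ∧ l.site v = t₀ + k) :
    HasVertRange m (termPerturbation T) := by
  intro X v
  obtain ⟨t₀, ht₀⟩ := hwin X v
  refine ⟨t₀, fun U V h => ?_⟩
  simp only [termPerturbation_act]
  refine sum_congr rfl fun r' hr' => (T r').dependsOn fun e he => h e ?_
  obtain ⟨l, hl, rfl⟩ := mem_wordEdges.1 (Finset.mem_coe.1 he)
  by_cases hv : l.dir = v
  · obtain ⟨k, hk, hkt⟩ := ht₀ r' hr' l hl hv
    exact Or.inr ⟨k, hk, hkt⟩
  · exact Or.inl hv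

end Summit.Ventures.YMGap.RobustBall

end
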